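import Summits.QuantumAdvantage.QuantumAdvantage.Theorems.LinnikCubicClassGroupsDegreeOnePrimesEscapeDeuringSmoothed
import Summits.QuantumAdvantage.QuantumAdvantage.Theorems.LinnikCubicClassGroupsDegreeOnePrimesEscapeRamifiedJunk
import Summits.QuantumAdvantage.QuantumAdvantage.Theorems.LinnikCubicClassGroupsDegreeOnePrimesEscapeWeightedPsi
import Summits.QuantumAdvantage.QuantumAdvantage.Theorems.LinnikCubicClassGroupsDegreeOnePrimesEscapeClassPNTFamilyDensity
import Summits.QuantumAdvantage.QuantumAdvantage.Theorems.LinnikCubicClassGroupsDegreeOnePrimesEscapeResidueAllFields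
import Literature.NumberTheory.LFunctions.CyclicExtensionHeckeFactorisation
import Literature.NumberTheory.LFunctions.DeuringHeilbronn
import HarnessLib

/-!
# The smoothed Chebotarev theorem for a cyclic extension in the Linnik range, two-sided, unconditionally

Topic `Summits/QuantumAdvantage/QuantumAdvantage/Theorems`, cell B2b-1 (linnik-cubic), PART A (gen 12); helper
toward the crux `DegreeOnePrimesEscape` (stmt-QuantumAdvantage-11543) — steps M1+M4+M5 of the LMO programme for
conjugacy classes inside a division, assembled at the smoothed level.  HONEST FRAMING: the value of this file is a
THEOREM (kernel-checked, GRH-free) — NOT summit progress.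

**Theorem** (`smoothedFrobenius_dichotomy`).  For `n > 1` and `η > 0` there are `ν, a₁, c` such that for every
cyclic extension `N|E` of number fields with `[N:ℚ] = n`, `1 < [E:ℚ]`, `m = [N:E]`, there is a faithful character
`χ₁` of `Gal(N|E)` such that for every `τ ∈ Gal(N|E)`, with
`T_τ(g) = Σ_{𝔭 unramified, Frob_𝔭^k = τ} log N𝔭 · g(log N𝔭^k)` (the smoothed count of prime powers of `E` with
Frobenius `τ`), `Q = |d_N| nⁿ`, `g_x = tzTest (log x) x^{−ν}` and all `x ≥ Q^{a₁}`:
EITHER `ζ₁_N` has no real zero in `(1 − c/(log|d_N| + log 4), 1)` and `|m T_τ(g_x) − F(−1)| ≤ η x + n ω(d_N)(log x + 1)`;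
OR `β₁` is such a zero, there is `j₀ < m` (independent of `τ`), and
`|m T_τ(g_x) − F(−1) + χ₁(τ)^{−j₀} F(−β₁)| ≤ η x min(1, (1 − β₁) log x) + n ω(d_N)(log x + 1)`.

Ingredients: the Hecke factorisation of `ζ_N` over `E` with primitive characters and transfer of zeros
(`CyclicExtension.exists_primitive_heckeFactorisation`), the Deuring-twisted dichotomy
(`deuringSum_dichotomy_dh`, fed with `fam_density_local`, `Residue.residueLowerBound_all`, `deuringHeilbronn`),
the Deuring coefficient identity (`norm_sum_coefFordK_sub_le`) and the ramified junk (`psiWeighted_ram_le`).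
References: [LagariasMontgomeryOdlyzko1979, §§3, 7]; [ThornerZaman2019, Thm. 1.4]; [Weiss1983, Thm. 5.2].
-/

noncomputable section

open Complex Real Finset NumberField IsDedekindDomain
open scoped NumberField nonZeroDivisors Classical

namespace Summit.QuantumAdvantage.QuantumAdvantage.Theorems.DegreeOnePrimesEscape

open Literature.NumberTheory.LFunctions Literature.NumberTheory.LFunctions.NumberField
  Literature.NumberTheory.LFunctions.EntireEF Literature.NumberTheory.LFunctions.TZWeight
  Literature.NumberTheory.LFunctions.AbelianDensity Literature.NumberTheory.GaloisRepresentations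

/-- `|χ₁(τ)^{-1}| ≤ 1` for a character of a finite group. -/
theorem norm_inv_character_le_one {G : Type*} [Group G] [Finite G] (χ₁ : G →* ℂˣ) (τ : G) :
    ‖((χ₁ τ : ℂˣ) : ℂ)⁻¹‖ ≤ 1 := by
  have hk := isOfFinOrder_iff_pow_eq_one.mp (isOfFinOrder_of_finite τ)
  obtain ⟨k, hk0, hkτ⟩ := hk
  have h1 : ((χ₁ τ : ℂˣ) : ℂ) ^ k = 1 := by
    rw [← Units.val_pow_eq_pow_val, ← map_pow, hkτ, map_one, Units.val_one]
  have hn : ‖((χ₁ τ : ℂˣ) : ℂ)‖ = 1 := by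
    have := congrArg norm h1
    rw [norm_pow, norm_one] at this
    exact (pow_eq_one_iff_of_nonneg (norm_nonneg _) hk0.ne').mp this
  rw [norm_inv, hn, inv_one]

set_option maxHeartbeats 3200000 in
/-- **The smoothed Chebotarev theorem for a cyclic extension in the Linnik range, two-sided, with the
exceptional zero of `ζ_N`** (see the module docstring). [cite: LagariasMontgomeryOdlyzko1979, §7]
[cite: ThornerZaman2019, Theorem 1.4] -/
theorem smoothedFrobenius_dichotomy (n₀ : ℕ) (hn₀ : 1 < n₀) {η : ℝ} (hη : 0 < η) :
    ∃ ν a₁ c : ℝ, 0 < ν ∧ ν ≤ 1 / 64 ∧ 1 ≤ a₁ ∧ 0 < c ∧ c ≤ 1 / (8 * ((n₀ : ℝ) ^ 2 + 1)) ∧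
    ∀ (E N : Type) [Field E] [NumberField E] [Field N] [NumberField N] [Algebra E N] [IsGalois E N]
      [IsCyclic (N ≃ₐ[E] N)], Module.finrank ℚ N = n₀ → 1 < Module.finrank ℚ E →
    ∃ χ₁ : (N ≃ₐ[E] N) →* ℂˣ, Function.Injective χ₁ ∧
      (∀ (τ : N ≃ₐ[E] N) (wτ : Ideal (𝓞 E) → ℝ),
        (∀ I, wτ I = if (∃ v : HeightOneSpectrum (𝓞 E), Algebra.IsUnramifiedIn (𝓞 N) v.asIdeal ∧
          ∃ k : ℕ, I = v.asIdeal ^ k ∧ galFrob E N v ^ k = τ) then 1 else 0) →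
        ∀ x : ℝ, ThornerZaman.condQn N ^ a₁ ≤ x →
          (¬ ∃ β₁ : ℝ, dedekindZeta₁ N β₁ = 0 ∧
            1 - c / (Real.log ((NumberField.discr N).natAbs : ℝ) + Real.log 4) < β₁ ∧ β₁ < 1) →
          ‖(Module.finrank E N : ℂ) *
                ((∑' k : ℕ, (∑ I ∈ idealsOfNorm E k, wτ I * idealVonMangoldt I) *
                  tzTest (Real.log x) (x ^ (-ν)) (Real.log k) : ℝ) : ℂ) -
              fordLaplace (tzTest (Real.log x) (x ^ (-ν))) (-1)‖ ≤
            η * x + n₀ * ((NumberField.discr N).natAbs.primeFactors.card) * (Real.log x + 1)) ∧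
      (∀ β₁ : ℝ, dedekindZeta₁ N β₁ = 0 →
          1 - c / (Real.log ((NumberField.discr N).natAbs : ℝ) + Real.log 4) < β₁ → β₁ < 1 →
        ∃ j₀ : ℕ, j₀ < Module.finrank E N ∧
        ∀ (τ : N ≃ₐ[E] N) (wτ : Ideal (𝓞 E) → ℝ),
          (∀ I, wτ I = if (∃ v : HeightOneSpectrum (𝓞 E), Algebra.IsUnramifiedIn (𝓞 N) v.asIdeal ∧
            ∃ k : ℕ, I = v.asIdeal ^ k ∧ galFrob E N v ^ k = τ) then 1 else 0) →
          ∀ x : ℝ, ThornerZaman.condQn N ^ a₁ ≤ x →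
            ‖(Module.finrank E N : ℂ) *
                  ((∑' k : ℕ, (∑ I ∈ idealsOfNorm E k, wτ I * idealVonMangoldt I) *
                    tzTest (Real.log x) (x ^ (-ν)) (Real.log k) : ℝ) : ℂ) -
                fordLaplace (tzTest (Real.log x) (x ^ (-ν))) (-1) +
                (((χ₁ τ : ℂˣ) : ℂ)⁻¹) ^ j₀ * fordLaplace (tzTest (Real.log x) (x ^ (-ν))) (-(β₁ : ℂ))‖ ≤
              η * x * min 1 ((1 - β₁) * Real.log x) +
                n₀ * ((NumberField.discr N).natAbs.primeFactors.card) * (Real.log x + 1)) := by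
  classical
  obtain ⟨A, -, hA⟩ := Residue.residueLowerBound_all n₀
  obtain ⟨b, D, hb, hD, hdens⟩ := fam_density_local n₀ hn₀ A
  have ha : (1 : ℝ) ≤ max A 4 := le_trans (by norm_num) (le_max_right _ _)
  obtain ⟨ν, a₁, c, hν0, hν64, ha₁1, hc, hcn, hmain⟩ :=
    deuringSum_dichotomy_dh n₀ hn₀ hb hD ha hη deuringHeilbronn
  refine ⟨ν, a₁, c, hν0, hν64, ha₁1, hc, hcn, ?_⟩
  intro E N _ _ _ _ _ _ _ hNn hE
  haveI : FiniteDimensional E N := Module.Finite.of_restrictScalars_finite ℚ E N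
  obtain ⟨χ₁, 𝔣, χ, p, L, hχ₁, hdata, hsupp, hval, h𝔣0, hχ0, hnt, -, hdisc, hL, -, hord⟩ :=
    CyclicExtension.exists_primitive_heckeFactorisation E N
  set m : ℕ := Module.finrank E N with hm
  have hm1 : 1 ≤ m := Module.finrank_pos
  have hdeg : Module.finrank ℚ N = Module.finrank ℚ E * m := (Module.finrank_mul_finrank ℚ E N).symm
  have hcard : Nat.card (N ≃ₐ[E] N) = m := IsGalois.card_aut_eq_finrank E N
  have hN : 1 < Module.finrank ℚ N := by rw [hNn]; exact hn₀
  -- sizes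
  set Q : ℝ := ThornerZaman.condQn N with hQ
  have hQ12 : (12 : ℝ) ≤ Q := ThornerZaman.twelve_le_condQn (K := N) hN
  have hQ1 : (1 : ℝ) < Q := by linarith
  -- `j ∈ Ico 1 m ⇒ ¬ m ∣ j`
  have hndvd : ∀ j ∈ Finset.Ico 1 m, ¬ m ∣ j := by
    intro j hj hdvd
    rw [Finset.mem_Ico] at hj
    exact absurd (Nat.le_of_dvd (by omega) hdvd) (by omega)
  -- the dual continuations
  have hex' : ∀ j, ∃ L' : ℂ → ℂ, j ∈ Finset.Ico 1 m →
      Differentiable ℂ L' ∧ ∀ s : ℂ, 1 < s.re → L' s = rayClassLSeries (𝔣 j) (star (χ j)) s := by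
    intro j
    by_cases hj : j ∈ Finset.Ico 1 m
    · obtain ⟨v, hv, hv1⟩ := hnt j (hndvd j hj)
      have hnt' : ∃ v : HeightOneSpectrum (𝓞 E), ¬ 𝔣 j ≤ v.asIdeal ∧ (star (χ j)) v ≠ 1 := by
        refine ⟨v, hv, fun h ↦ hv1 ?_⟩
        rw [Pi.star_apply, Complex.star_def] at h
        have := congrArg (starRingEnd ℂ) h
        rwa [Complex.conj_conj, map_one] at this
      obtain ⟨L', hL'd, hL's⟩ := exists_differentiable_eq_rayClassLSeries (hdata j).1 (hdata j).2.1.star hnt'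
      exact ⟨L', fun _ ↦ ⟨hL'd, hL's⟩⟩
    · exact ⟨fun _ ↦ 0, fun h ↦ absurd h hj⟩
  choose L' hL' using hex'
  -- conductor–discriminant consequences
  have hdN0 : 0 < (NumberField.discr N).natAbs := Int.natAbs_pos.mpr (NumberField.discr_ne_zero N)
  have hfac : ∀ j ∈ Finset.range m, (NumberField.discr E).natAbs * Ideal.absNorm (𝔣 j) ≤ (NumberField.discr N).natAbs :=
    fun j hj ↦ Nat.le_of_dvd hdN0 (hdisc ▸ Finset.dvd_prod_of_mem _ hj)
  have hcond : ∀ j ∈ Finset.Ico 1 m, |(NumberField.discr E : ℝ)| * (Ideal.absNorm (𝔣 j) : ℝ) ≤ (NumberField.discr N).natAbs := by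
    intro j hj
    have h := hfac j (Finset.mem_range.mpr (Finset.mem_Ico.mp hj).2)
    rw [← Int.cast_abs, ← Nat.cast_natAbs]
    exact_mod_cast h
  have hdE : ((NumberField.discr E).natAbs : ℝ) ≤ (NumberField.discr N).natAbs := by
    have h := hfac 0 (Finset.mem_range.mpr hm1)
    rw [h𝔣0, Ideal.absNorm_top, mul_one] at h
    exact_mod_cast h
  -- the Deuring-twisted dichotomy
  obtain ⟨hcaseA, hcaseB⟩ := hmain E N hNn hE (hdens N hNn (hA N hNn)) m hm1 hdeg 𝔣 χ p L L' hdata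
    (fun j hj ↦ hnt j (hndvd j hj)) (fun j hj ↦ hL j (hndvd j hj)) (fun j hj ↦ hL' j hj) hord h𝔣0 hχ0 hcond hdE
  -- the Deuring coefficient identity and the ramified junk, at `x ≥ Q^{a₁}`
  set wr : Ideal (𝓞 E) → ℝ := fun I ↦ if (∃ v : HeightOneSpectrum (𝓞 E), ¬ Algebra.IsUnramifiedIn (𝓞 N) v.asIdeal ∧
      ∃ k : ℕ, 0 < k ∧ I = v.asIdeal ^ k) then 1 else 0 with hwrdef
  have hwr : ∀ I, wr I = if (∃ v : HeightOneSpectrum (𝓞 E), ¬ Algebra.IsUnramifiedIn (𝓞 N) v.asIdeal ∧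
      ∃ k : ℕ, 0 < k ∧ I = v.asIdeal ^ k) then 1 else 0 := fun I ↦ rfl
  have hray : ∀ j, 𝔣 j ≠ ⊥ ∧ IsRayClassCharacter (𝔣 j) (χ j) := fun j ↦ ⟨(hdata j).1, (hdata j).2.1⟩
  have hjunk : ∀ (τ : N ≃ₐ[E] N) (wτ : Ideal (𝓞 E) → ℝ),
      (∀ I, wτ I = if (∃ v : HeightOneSpectrum (𝓞 E), Algebra.IsUnramifiedIn (𝓞 N) v.asIdeal ∧
        ∃ k : ℕ, I = v.asIdeal ^ k ∧ galFrob E N v ^ k = τ) then 1 else 0) →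
      ∀ x : ℝ, Q ^ a₁ ≤ x →
      ‖∑ j ∈ Finset.range m, (((χ₁ τ : ℂˣ) : ℂ)⁻¹) ^ j * coefFordK (rcCoef (𝔣 j) (χ j)) (tzTest (Real.log x) (x ^ (-ν))) 0 -
          (m : ℂ) * ((∑' k : ℕ, (∑ I ∈ idealsOfNorm E k, wτ I * idealVonMangoldt I) *
            tzTest (Real.log x) (x ^ (-ν)) (Real.log k) : ℝ) : ℂ)‖ ≤
        n₀ * ((NumberField.discr N).natAbs.primeFactors.card) * (Real.log x + 1) := by
    intro τ wτ hwτ x hx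
    have hxQ : Q ≤ x := by
      have : Q ^ (1 : ℝ) ≤ Q ^ a₁ := Real.rpow_le_rpow_of_exponent_le hQ1.le ha₁1
      rw [Real.rpow_one] at this; linarith
    have hx1 : 1 < x := by linarith
    have hx0 : 0 < x := by linarith
    have hL0 : 0 < Real.log x := Real.log_pos hx1
    set ε : ℝ := x ^ (-ν) with hε
    have hε0 : 0 < ε := Real.rpow_pos_of_pos hx0 _
    have hε1 : ε ≤ 1 := Real.rpow_le_one_of_one_le_of_nonpos hx1.le (by linarith)
    have h1 := norm_sum_coefFordK_sub_le hχ₁ hcard hray hsupp hval τ hwτ hwr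
      (g := tzTest (Real.log x) ε) (X := Real.log x + ε) (fun u hu ↦ tzTest_eq_zero_of_ge hL0 hε0 hu)
    -- `|g| = g` and the smoothed junk is at most `ψ_{w_ram}(x e^ε)`
    have habs : ∀ k : ℕ, |tzTest (Real.log x) ε (Real.log k)| = tzTest (Real.log x) ε (Real.log k) :=
      fun k ↦ abs_of_nonneg (tzTest_mem_Icc _ _ _).1
    simp_rw [habs] at h1
    have hw0 : ∀ I, 0 ≤ wr I := fun I ↦ by rw [hwr I]; split_ifs <;> norm_num
    have h2 := smoothedPsiWeighted_le_psiWeighted (K := E) (w := wr) hw0 hx1 hε0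
    have hy : (1 : ℝ) ≤ x * Real.exp ε := by
      have : 1 ≤ Real.exp ε := by linarith [Real.add_one_le_exp ε]
      nlinarith
    have h3 := psiWeighted_ram_le (E := E) (N := N) hwr hy
    have hlogy : Real.log (x * Real.exp ε) = Real.log x + ε := by
      rw [Real.log_mul hx0.ne' (Real.exp_pos ε).ne', Real.log_exp]
    rw [hlogy] at h3
    have hω0 : (0 : ℝ) ≤ ((NumberField.discr N).natAbs.primeFactors.card : ℝ) := Nat.cast_nonneg _
    have hnE0 : (0 : ℝ) ≤ Module.finrank ℚ E := Nat.cast_nonneg _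
    have h4 : (m : ℝ) * (∑' k : ℕ, (∑ I ∈ idealsOfNorm E k, wr I * idealVonMangoldt I) * tzTest (Real.log x) ε (Real.log k)) ≤
        n₀ * ((NumberField.discr N).natAbs.primeFactors.card) * (Real.log x + 1) := by
      have hm0 : (0 : ℝ) ≤ m := Nat.cast_nonneg _
      calc (m : ℝ) * (∑' k : ℕ, (∑ I ∈ idealsOfNorm E k, wr I * idealVonMangoldt I) * tzTest (Real.log x) ε (Real.log k))
          ≤ m * (Module.finrank ℚ E * ((NumberField.discr N).natAbs.primeFactors.card) * (Real.log x + ε)) :=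
            mul_le_mul_of_nonneg_left (h2.trans h3) hm0
        _ = n₀ * ((NumberField.discr N).natAbs.primeFactors.card) * (Real.log x + ε) := by
            rw [← hNn, hdeg]; push_cast; ring
        _ ≤ n₀ * ((NumberField.discr N).natAbs.primeFactors.card) * (Real.log x + 1) := by
            refine mul_le_mul_of_nonneg_left (by linarith) (by positivity)
    exact h1.trans h4
  refine ⟨χ₁, hχ₁, fun τ wτ hwτ x hx hnoexc ↦ ?_, fun β₁ hζ hwin hβ1 ↦ ?_⟩
  · -- (A)
    have hA' := hcaseA (((χ₁ τ : ℂˣ) : ℂ)⁻¹) (norm_inv_character_le_one χ₁ τ) x hx hnoexc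
    have hJ := hjunk τ wτ hwτ x hx
    -- triangle inequality
    have := norm_sub_le_norm_sub_add_norm_sub
      ((m : ℂ) * ((∑' k : ℕ, (∑ I ∈ idealsOfNorm E k, wτ I * idealVonMangoldt I) *
        tzTest (Real.log x) (x ^ (-ν)) (Real.log k) : ℝ) : ℂ))
      (∑ j ∈ Finset.range m, (((χ₁ τ : ℂˣ) : ℂ)⁻¹) ^ j * coefFordK (rcCoef (𝔣 j) (χ j)) (tzTest (Real.log x) (x ^ (-ν))) 0)
      (fordLaplace (tzTest (Real.log x) (x ^ (-ν))) (-1))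
    rw [norm_sub_rev] at hJ
    linarith
  · -- (B)
    obtain ⟨j₀, hj₀m, -, hB⟩ := hcaseB β₁ hζ hwin hβ1
    refine ⟨j₀, hj₀m, fun τ wτ hwτ x hx ↦ ?_⟩
    have hB' := hB (((χ₁ τ : ℂˣ) : ℂ)⁻¹) (norm_inv_character_le_one χ₁ τ) x hx
    have hJ := hjunk τ wτ hwτ x hx
    set T : ℂ := ((m : ℂ) * ((∑' k : ℕ, (∑ I ∈ idealsOfNorm E k, wτ I * idealVonMangoldt I) *
        tzTest (Real.log x) (x ^ (-ν)) (Real.log k) : ℝ) : ℂ)) with hT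
    set S : ℂ := ∑ j ∈ Finset.range m, (((χ₁ τ : ℂˣ) : ℂ)⁻¹) ^ j *
        coefFordK (rcCoef (𝔣 j) (χ j)) (tzTest (Real.log x) (x ^ (-ν))) 0 with hS
    set F1 : ℂ := fordLaplace (tzTest (Real.log x) (x ^ (-ν))) (-1) with hF1
    set Fβ : ℂ := (((χ₁ τ : ℂˣ) : ℂ)⁻¹) ^ j₀ * fordLaplace (tzTest (Real.log x) (x ^ (-ν))) (-(β₁ : ℂ)) with hFβ
    have he : T - F1 + Fβ = (S - F1 + Fβ) + (T - S) := by ring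
    rw [he]
    refine (norm_add_le _ _).trans ?_
    rw [norm_sub_rev] at hJ
    linarith

end Summit.QuantumAdvantage.QuantumAdvantage.Theorems.DegreeOnePrimesEscape
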